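import Literature.MathematicalPhysics.QuantumLattice.CanonicalVariationalPressure
import Literature.MathematicalPhysics.QuantumLattice.LayeredHubbardGrandCanonicalVariationalPressure
import HarnessLib

/-!
# THERMAL ENERGY WINDOWS from three pressures at neighbouring TEMPERATURES, with slack, and the layered `t–t'` crystal:
# the energy density of 3D thermal states at `(β, ρ)` is bracketed by the 2D canonical pressures `p(β−δ), p(β), p(β+δ)`

Topic `Literature/MathematicalPhysics/QuantumLattice` (family `hubbard`; crew hubbard-fast S2, written for the hubbard-thermal deliverable «one
certified thermal ENERGY window at `(8, ⅞, 0)`, `T = t/4`» and D-0096 (iii) «interlayer coupling»). The `β`-direction companion of the Griffiths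
windows with slack of `LayeredVariationalPressure` §3 / `CanonicalVariationalPressure` §1: the conjugate of `β` is the ENERGY.

* §1 **Energy from pressures at neighbouring temperatures, with slack** (every model, every dimension): if `ν` is translation invariant with
  `s̄(ν) − βe_Φ(ν) ≥ P(β,Φ) − ε` then for every `δ > 0`
  **`(P(β) − P(β+δ) − ε)/δ ≤ e_Φ(ν) ≤ (P(β−δ) − P(β) + ε)/δ`** (`meanEnergy_mem_Icc_of_approx_beta`; `P(·) = P(·,Φ)` convex in `β`); the
  same at fixed density with `P(·,Φ;ρ)` (`meanEnergy_mem_Icc_of_approxAt_beta`); exact equilibria: `ε = 0` (`IsVarEquilibrium.meanEnergy_mem_Icc_beta`).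
* §2 **2D `t–t'` Hubbard, canonical**: for a translation-invariant 2D state of density `ρ` within `ε` of `p(β;ρ) = pressureTT' β t t' U ρ`
  (`0 < δ < β`, `U ≥ 0`, `0 < ρ < 2`): `e_Φ ∈ [(p(β) − p(β+δ) − ε)/δ, (p(β−δ) − p(β) + ε)/δ]` (`meanEnergy_mem_Icc_pressureTT'_of_approxAt`) — three
  certified canonical pressures give a certified thermal energy window for every near-equilibrium state (canonical thermal torus-limit states
  are exact: `ε = 0`).
* §3 **THE LAYERED CRYSTAL** (`layeredHubbardTTPrime`, interlayer amplitudes `tz_b` along `w_b`, `(w_b)₀ ≠ 0`): a translation-invariant 3D state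
  `ω` of density `ρ` within `ε'` of `P_3(β;ρ)` has layer-marginal energy
  `e_Φ(ω∘Γ_layer) ∈ [(p(β) − p(β+δ) − ε)/δ, (p(β−δ) − p(β) + ε)/δ]`, `ε = ε' + β(4/π)Σ|tz|`
  (`…meanEnergy_layerMarginal_mem_Icc_pressureTT'`), and **3D energy density
  `e_3(ω) ∈ [(p(β) − p(β+δ) − ε)/δ − (4/π)Σ|tz|, (p(β−δ) − p(β) + ε)/δ + (4/π)Σ|tz|]`** (`…meanEnergy_layered_mem_Icc_pressureTT'`):
  **the thermal crew's three canonical 2D pressures at `(β−δ, β, β+δ)` certify the thermal energy of the 3D layered crystal.** Grand-canonical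
  twin with `gcPressureTT'Zeeman` (`IsVarEquilibrium.meanEnergy_layerMarginal_mem_Icc_gcPressureTT'Zeeman`).

Everything is PROVED; no definition, no named fact, no number.

## Mathlib / tree search

REUSED: `varPressure_add_le_of_approx` (`LayeredVariationalPressure`), `varPressureAt_add_le_of_approxAt`, `varPressureAt_hubbardTTPrime_eq`,
`IsTranslationInvariant.pressureTT'_sub_le_layerMarginal_of_approxAt` (`CanonicalVariationalPressure`), `IsVarEquilibrium.gcPressureTT'Zeeman_sub_le_layerMarginal`,
`varPressure_gcInteractionTT'_eq` (`LayeredHubbardGrandCanonicalVariationalPressure`, `TIVariationalPressure`), `IsTranslationInvariant.abs_meanEnergy_layeredModel_sub_mapAct_le`,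
`layeredHubbardTTPrime`, `hubbardTTPrimeFermionInteraction_eq_vectorHoppingModel`. `lean search 'mem_Icc.*beta|energy window.*pressure.*beta'` (2026-08-28):
`HubbardTTPrimeCanonicalThermalStatesMonotone` (tangent lines in `β` for canonical torus-limit states, exact); nothing with slack / layered.

## References

* R. B. Israel, *Convexity in the Theory of Lattice Gases* (1979), Thm. I.2.4 (energy = −∂P/∂β as a one-sided derivative bracket). [cite: Israel1979, Thm. I.2.4]
* R. B. Griffiths, J. Math. Phys. 5 (1964) 1215, eq. (39). [cite: Griffiths1964, Eq. (39) and Fig. 3]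
* O. Bratteli, A. Kishimoto, D. W. Robinson, Commun. Math. Phys. 64 (1978) 41, Thm. 2. [cite: BratteliKishimotoRobinson1978, Thm. 2 (condition 2)]
-/

noncomputable section

open scoped ComplexOrder BigOperators
open Finset Literature.InformationTheory.Entropy

namespace Literature.MathematicalPhysics.QuantumLattice

open Matrix HubbardWave0 Literature.Probability.LatticeModels ThermodynamicLimit

/-! ### §1 Energy from pressures at neighbouring temperatures, with slack -/

namespace InfVolFermionState

variable {d : ℕ} {β ε R ρ : ℝ} {Φ : FermionInteraction d} {ν : InfVolFermionState d}

/-- **ENERGY WINDOW WITH SLACK**: an `ε`-approximate equilibrium `ν` at `β` has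
`(P(β) − P(β+δ) − ε)/δ ≤ e_Φ(ν) ≤ (P(β−δ) − P(β) + ε)/δ` for every `δ > 0`. [cite: Israel1979, Thm. I.2.4] [cite: Griffiths1964, Eq. (39) and Fig. 3] -/
theorem meanEnergy_mem_Icc_of_approx_beta (hν : ν.IsTranslationInvariant)
    (h : Φ.varPressure β R - ε ≤ ν.entropyDensitySup - β * ν.meanEnergy Φ R) {δ : ℝ} (hδ : 0 < δ) :
    ν.meanEnergy Φ R ∈ Set.Icc ((Φ.varPressure β R - Φ.varPressure (β + δ) R - ε) / δ)
      ((Φ.varPressure (β - δ) R - Φ.varPressure β R + ε) / δ) := by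
  have hup := varPressure_add_le_of_approx hν h (β + δ) Φ R
  have hdn := varPressure_add_le_of_approx hν h (β - δ) Φ R
  constructor
  · rw [div_le_iff₀ hδ]; linarith
  · rw [le_div_iff₀ hδ]; linarith

/-- **Energy window with slack at fixed density** (`P(·) = P(·,Φ;ρ)`). [cite: Israel1979, Thm. I.2.4] -/
theorem meanEnergy_mem_Icc_of_approxAt_beta (hν : ν.IsTranslationInvariant) (hρ : ν.density = ρ)
    (h : Φ.varPressureAt β R ρ - ε ≤ ν.entropyDensitySup - β * ν.meanEnergy Φ R) {δ : ℝ} (hδ : 0 < δ) :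
    ν.meanEnergy Φ R ∈ Set.Icc ((Φ.varPressureAt β R ρ - Φ.varPressureAt (β + δ) R ρ - ε) / δ)
      ((Φ.varPressureAt (β - δ) R ρ - Φ.varPressureAt β R ρ + ε) / δ) := by
  have hup := varPressureAt_add_le_of_approxAt hν hρ h (β + δ) Φ R
  have hdn := varPressureAt_add_le_of_approxAt hν hρ h (β - δ) Φ R
  constructor
  · rw [div_le_iff₀ hδ]; linarith
  · rw [le_div_iff₀ hδ]; linarith

/-- **Exact equilibria**: `(P(β) − P(β+δ))/δ ≤ e_Φ(ω) ≤ (P(β−δ) − P(β))/δ`. [cite: Israel1979, Thm. I.2.4] -/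
theorem IsVarEquilibrium.meanEnergy_mem_Icc_beta {ω : InfVolFermionState d} (h : ω.IsVarEquilibrium β Φ R) {δ : ℝ} (hδ : 0 < δ) :
    ω.meanEnergy Φ R ∈ Set.Icc ((Φ.varPressure β R - Φ.varPressure (β + δ) R) / δ)
      ((Φ.varPressure (β - δ) R - Φ.varPressure β R) / δ) := by
  have h0 : Φ.varPressure β R - 0 ≤ ω.entropyDensitySup - β * ω.meanEnergy Φ R := by rw [sub_zero, h.2]
  have w := meanEnergy_mem_Icc_of_approx_beta h.1 h0 hδ
  simp only [sub_zero, add_zero] at w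
  exact w

end InfVolFermionState

/-! ### §2 The 2D `t–t'` Hubbard model, canonical: thermal energy from three canonical pressures -/

section Hubbard2D

/-- **THERMAL ENERGY FROM THREE CANONICAL PRESSURES (2D)**: for `0 < δ < β`, `U ≥ 0`, `0 < ρ < 2` and a translation-invariant state `ν` of
density `ρ` with `s̄(ν) − βe_Φ(ν) ≥ p(β;ρ) − ε` (`p = pressureTT' · t t' U ρ`; canonical thermal torus-limit states have `ε = 0`):
`(p(β) − p(β+δ) − ε)/δ ≤ e_Φ(ν) ≤ (p(β−δ) − p(β) + ε)/δ`. [cite: Israel1979, Thm. I.2.4] [cite: Griffiths1964, Eq. (39) and Fig. 3] -/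
theorem InfVolFermionState.IsTranslationInvariant.meanEnergy_mem_Icc_pressureTT'_of_approxAt {β δ : ℝ} (hδ : 0 < δ) (hδβ : δ < β)
    (t t' : ℝ) {U : ℝ} (hU : 0 ≤ U) {ρ : ℝ} (hρ0 : 0 < ρ) (hρ2 : ρ < 2) {ν : InfVolFermionState 2} (hν : ν.IsTranslationInvariant)
    (hνρ : ν.density = ρ) {ε : ℝ}
    (h : pressureTT' β t t' U ρ - ε ≤ ν.entropyDensitySup - β * ν.meanEnergy (hubbardTTPrimeFermionInteraction t t' U) 1) :
    ν.meanEnergy (hubbardTTPrimeFermionInteraction t t' U) 1 ∈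
      Set.Icc ((pressureTT' β t t' U ρ - pressureTT' (β + δ) t t' U ρ - ε) / δ)
        ((pressureTT' (β - δ) t t' U ρ - pressureTT' β t t' U ρ + ε) / δ) := by
  have hβ : 0 < β := hδ.trans hδβ
  rw [← varPressureAt_hubbardTTPrime_eq hβ t t' hU hρ0 hρ2] at h
  have w := InfVolFermionState.meanEnergy_mem_Icc_of_approxAt_beta hν hνρ h hδ
  rw [varPressureAt_hubbardTTPrime_eq hβ t t' hU hρ0 hρ2, varPressureAt_hubbardTTPrime_eq (by linarith) t t' hU hρ0 hρ2,
    varPressureAt_hubbardTTPrime_eq (by linarith) t t' hU hρ0 hρ2] at w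
  exact w

end Hubbard2D

/-! ### §3 The layered `t–t'` crystal: 3D thermal energies from three 2D pressures -/

section Layered

variable {κ : Type*} [Fintype κ]

/-- **LAYER-MARGINAL ENERGY OF 3D THERMAL STATES FROM THREE 2D CANONICAL PRESSURES**: for `0 < δ < β`, `U ≥ 0`, `0 < ρ < 2`, interlayer
vectors `w_b` with `(w_b)₀ ≠ 0` in the range box `R' ≥ 1`, and a translation-invariant 3D state `ω` of density `ρ` within `ε'` of
`P_3(β; ρ)`: with `p(·) = pressureTT' · t t' U ρ` and `ε = ε' + β(4/π)Σ_b|tz_b|`,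
`(p(β) − p(β+δ) − ε)/δ ≤ e_Φ(ω∘Γ_layer) ≤ (p(β−δ) − p(β) + ε)/δ`.
[cite: BratteliKishimotoRobinson1978, Thm. 2 (condition 2)] [cite: Israel1979, Thm. I.2.4] -/
theorem InfVolFermionState.IsTranslationInvariant.meanEnergy_layerMarginal_mem_Icc_pressureTT' {β δ : ℝ} (hδ : 0 < δ) (hδβ : δ < β)
    (t t' : ℝ) {U : ℝ} (hU : 0 ≤ U) {w : κ → Site 3} (hw : ∀ b, w b 0 ≠ 0) (tz : κ → ℝ) {R' : ℝ} (hR' : 1 ≤ R')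
    (hwR' : ∀ b, w b ∈ thicken ({0} : Finset (Site 3)) R') {ρ : ℝ} (hρ0 : 0 < ρ) (hρ2 : ρ < 2)
    {ω : InfVolFermionState 3} (hω : ω.IsTranslationInvariant) (hωρ : ω.density = ρ) {ε' : ℝ}
    (happ : (layeredHubbardTTPrime t t' U w tz).varPressureAt β R' ρ - ε' ≤
      ω.entropyDensitySup - β * ω.meanEnergy (layeredHubbardTTPrime t t' U w tz) R') :
    (ω.mapAct (layerHom 2) (layerHom_injective 2)).meanEnergy (hubbardTTPrimeFermionInteraction t t' U) 1 ∈
      Set.Icc ((pressureTT' β t t' U ρ - pressureTT' (β + δ) t t' U ρ - (ε' + β * (4 / Real.pi * ∑ b, |tz b|))) / δ)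
        ((pressureTT' (β - δ) t t' U ρ - pressureTT' β t t' U ρ + (ε' + β * (4 / Real.pi * ∑ b, |tz b|))) / δ) := by
  have hβ : 0 < β := hδ.trans hδβ
  have happm := hω.pressureTT'_sub_le_layerMarginal_of_approxAt hβ t t' hU hw tz hR' hwR' hρ0 hρ2 happ
  have hm : (ω.mapAct (layerHom 2) (layerHom_injective 2)).IsTranslationInvariant := hω.mapAct (layerHom 2) (layerHom_injective 2)
  have hmρ : (ω.mapAct (layerHom 2) (layerHom_injective 2)).density = ρ := by
    rw [InfVolFermionState.density_mapAct _ _ _ (map_zero _), hωρ]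
  exact hm.meanEnergy_mem_Icc_pressureTT'_of_approxAt hδ hδβ t t' hU hρ0 hρ2 hmρ happm

/-- **3D THERMAL ENERGY DENSITY OF THE LAYERED CRYSTAL FROM THREE 2D CANONICAL PRESSURES**: under the same hypotheses the layered-crystal
energy density `e_3(ω) = e_{layeredHubbardTTPrime}(ω)` satisfies
`(p(β) − p(β+δ) − ε)/δ − (4/π)Σ|tz| ≤ e_3(ω) ≤ (p(β−δ) − p(β) + ε)/δ + (4/π)Σ|tz|`.
[cite: BratteliKishimotoRobinson1978, Thm. 2 (condition 2)] [cite: Israel1979, Thm. I.2.4] -/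
theorem InfVolFermionState.IsTranslationInvariant.meanEnergy_layered_mem_Icc_pressureTT' {β δ : ℝ} (hδ : 0 < δ) (hδβ : δ < β)
    (t t' : ℝ) {U : ℝ} (hU : 0 ≤ U) {w : κ → Site 3} (hw : ∀ b, w b 0 ≠ 0) (tz : κ → ℝ) {R' : ℝ} (hR' : 1 ≤ R')
    (hwR' : ∀ b, w b ∈ thicken ({0} : Finset (Site 3)) R') {ρ : ℝ} (hρ0 : 0 < ρ) (hρ2 : ρ < 2)
    {ω : InfVolFermionState 3} (hω : ω.IsTranslationInvariant) (hωρ : ω.density = ρ) {ε' : ℝ}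
    (happ : (layeredHubbardTTPrime t t' U w tz).varPressureAt β R' ρ - ε' ≤
      ω.entropyDensitySup - β * ω.meanEnergy (layeredHubbardTTPrime t t' U w tz) R') :
    ω.meanEnergy (layeredHubbardTTPrime t t' U w tz) R' ∈
      Set.Icc ((pressureTT' β t t' U ρ - pressureTT' (β + δ) t t' U ρ - (ε' + β * (4 / Real.pi * ∑ b, |tz b|))) / δ -
          4 / Real.pi * ∑ b, |tz b|)
        ((pressureTT' (β - δ) t t' U ρ - pressureTT' β t t' U ρ + (ε' + β * (4 / Real.pi * ∑ b, |tz b|))) / δ +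
          4 / Real.pi * ∑ b, |tz b|) := by
  have w := hω.meanEnergy_layerMarginal_mem_Icc_pressureTT' hδ hδβ t t' hU hw tz hR' hwR' hρ0 hρ2 hωρ happ
  have hdiff := hω.abs_meanEnergy_layeredModel_sub_mapAct_le U ttPrimeVec_ne_zero (ttPrimeAmp t t')
    (fun b h0 => hw b (by rw [h0]; rfl)) tz le_rfl hR' ttPrimeVec_mem_thicken_one hwR'
  rw [← hubbardTTPrimeFermionInteraction_eq_vectorHoppingModel, abs_le] at hdiff
  rw [layeredHubbardTTPrime, Set.mem_Icc]
  rw [Set.mem_Icc] at w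
  constructor
  · linarith [w.1, hdiff.1]
  · linarith [w.2, hdiff.2]

/-- **Grand-canonical twin**: for an equilibrium state `ω` of the layered grand-canonical crystal at `(β; t,t',U; μ,h)` (`0 < δ ≤ β`, `U ≥ 0`),
with `P(·) = gcPressureTT'Zeeman · t t' U μ h` and `ε = β(4/π)Σ|tz|`:
`(P(β) − P(β+δ) − ε)/δ ≤ u(ω∘Γ_layer) ≤ (P(β−δ) − P(β) + ε)/δ` (`u` = 2D grand-canonical energy of the layer marginal).
[cite: BratteliKishimotoRobinson1978, Thm. 2 (condition 2)] [cite: Israel1979, Thm. I.2.4] -/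
theorem InfVolFermionState.IsVarEquilibrium.meanEnergy_layerMarginal_mem_Icc_gcPressureTT'Zeeman {β δ : ℝ} (hδ : 0 < δ)
    (hδβ : δ ≤ β) (t t' : ℝ) {U : ℝ} (hU : 0 ≤ U) (μ hz : ℝ) {w : κ → Site 3} (hw : ∀ b, w b 0 ≠ 0) (tz : κ → ℝ)
    {R' : ℝ} (hR' : 1 ≤ R') (hwR' : ∀ b, w b ∈ thicken ({0} : Finset (Site 3)) R') {ω : InfVolFermionState 3}
    (hω : ω.IsVarEquilibrium β (gcLayeredHubbardTTPrime t t' U μ hz w tz) R') :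
    (ω.mapAct (layerHom 2) (layerHom_injective 2)).meanEnergy (gcInteractionTT' t t' U μ hz) 1 ∈
      Set.Icc ((gcPressureTT'Zeeman β t t' U μ hz - gcPressureTT'Zeeman (β + δ) t t' U μ hz - β * (4 / Real.pi * ∑ b, |tz b|)) / δ)
        ((gcPressureTT'Zeeman (β - δ) t t' U μ hz - gcPressureTT'Zeeman β t t' U μ hz + β * (4 / Real.pi * ∑ b, |tz b|)) / δ) := by
  have hβ : 0 ≤ β := hδ.le.trans hδβ
  have happ := hω.gcPressureTT'Zeeman_sub_le_layerMarginal hβ t t' hU μ hz hw tz hR' hwR'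
  rw [← varPressure_gcInteractionTT'_eq hβ t t' hU μ hz] at happ
  have w := InfVolFermionState.meanEnergy_mem_Icc_of_approx_beta (hω.1.mapAct (layerHom 2) (layerHom_injective 2)) happ hδ
  rw [varPressure_gcInteractionTT'_eq hβ t t' hU μ hz, varPressure_gcInteractionTT'_eq (by linarith) t t' hU μ hz,
    varPressure_gcInteractionTT'_eq (by linarith) t t' hU μ hz] at w
  exact w

end Layered

end Literature.MathematicalPhysics.QuantumLattice

end
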